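import Literature.AnabelianGeometry.EtaleTheta.TemperedFrobenioidCor38SubUnitNegative
import Literature.AlgebraicGeometry.Frobenioids.ModelFrobenioidAutDescent
import HarnessLib

/-!
# [EtTh] Rmk. 3.6.3, OBJECT clause (row C38-L10a `HullEssImageObjClause`, FACT-LIST F-2824) is a SCHEMA over the
# typed Def. 3.6 interface — its universal closure is refuted by a UNIT of `Φ`

S. Mochizuki, *The étale theta function and its Frobenioid-theoretic manifestations*, Publ. RIMS **45** (2009)
[EtTh], Rmk. 3.6.3, PDF pp. 78–79: "the objects of the essential image of the natural functor `C^{bs-fld} → C` may be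
described as the objects of `C` that may be 'linked' to a Frobenius-trivial object via base-field theoretic
pre-steps" [cite: MochizukiEtTh2009, Rmk 3.6.3 p.79]; Def. 3.6 (ii)/(iv) PDF pp. 77–78
[cite: MochizukiEtTh2009, Def 3.6 p.77]; [FrdI] Def. 1.2 (iii)/(iv) p. 22, Thm. 5.2 (i) p. 100
[cite: MochizukiFrdI2008, Thm. 5.2(i) p.100].

PROOF-ONLY companion (0 definitions) of abc-iut-w5-d124's statements-first sub-DAG file `TemperedFrobenioidCor38Sub.lean`,
row C38-L10a = `TemperedFrobenioid.HullEssImageObjClause` (`preparatory`, `parametrised` over the binders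
`(D₀, V, T, D, VD, C)` of the typed Def. 3.6 interface), abc-iut cell block F (fact-proving wave), seat abc-iut-f-045.
Toy data = abc-iut-f-135's `UnitToy.frdFull` (`TemperedFrobenioidUnitToy(Shift).lean`): `D = D₀ = pt`,
`Φ = Φ^{ℝ-log} = ℤ × ℕ` with the UNIT `n₀ = (1,0)`, `B₀^Λ = ℤ` with `div(b) = (0,b)`, `ℝ·Φ₀^cnst = 0 ⊕ ℤ`,
`Φ^{bs-fld} = 0 × ℕ`; the isomorphism `shiftIso : (•, α) ≅ (•, α + n₀)` and its bookkeeping are f-135's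
(`TemperedFrobenioidCor38SubUnitNegative.lean`: `isFrobeniusTrivial_A0`, `mem_ratFn`, `fstR_ΦgpToRlog_of`).

WHY THE CLOSURE IS FALSE (an interface finding, not a statement about [EtTh]). For a tempered Frobenioid AS TYPED write
`ι : (Φ^{bs-fld})^gp → Φ^gp` and `Div_B(B) ⊆ Φ^gp` (a subgroup, `B` being group-like). Unwinding [FrdI] Thm. 5.2 (i):
* the isomorphisms of `C` are the arrows `(1, Base ≅, Div = a UNIT of Φ, u)`, so `(A, α)` lies in the essential image
  of `C^{bs-fld} → C` iff `α ∈ ι((Φ^{bs-fld})^gp) · of(Φ(A)ˣ) · Div_B(B(A))` (the unit part, over ANY vocabulary: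
  `TemperedFrobenioid.essImageObj_hull_of_isUnit`, from L1's `ModelFrobenioid.isIso_of_isUnit_div`);
* `(A, α)` is Frobenius-trivial iff `α ∈ Div_B(B(A))` (from `ζ(2) = (2, id, 0, u)`: `2α = α + Div_B(u)`), and a
  base-field-theoretic pre-step `(1, Base ≅, Div ∈ Φ^{bs-fld}, u)` moves `α` inside its coset of
  `ι((Φ^{bs-fld})^gp) · Div_B(B)`; so "linked to a Frobenius-trivial object" says `α ∈ ι((Φ^{bs-fld})^gp) · Div_B(B(A))`.
Hence the two sides of the clause differ EXACTLY by the classes of units `of(Φ(A)ˣ)`: for print's `Φ` (perf-factorial,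
hence divisorial, hence SHARP) they agree — this is abc-iut-w5-d124/w5-d070's `hullEssImageObjClause_holds` at the tree
vocabulary `treeMonoidVocab` (`Discharge/Sec3Cor38HullObjects.lean`, p417120) and `hullEssImageObjClause_holds_weak` at
`treeMonoidVocabWeak` (`Discharge/Sec3Cor38HullObjectsWeak.lean`), the instance forms the cone consumes
(`Sec3Cor38RowsAssembly`, `Sec3Cor38iiOfInputs`, `Sec3Cor38Cor411ii`, `Sec3Cor38iiWeak`) — but the typed interface records
"perf-factorial … divisorial" only as the FREE predicates `V.IsPerfFactorial` / `VD.IsDivisorialOn`, so at the trivial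
vocabulary `Φ = ℤ × ℕ` is admissible, and at `UnitToy.frdFull` the object `Ψ(•,0) = (•, n₀)`
* IS in the essential image (`(•, n₀) ≅ (•, 0) = hull(•, 0)` by the unit isomorphism, `essImageObj_hull_shift_A0`), yet
* is NOT linked to any Frobenius-trivial object: the `ℤ`-coordinate of the class is `0` on Frobenius-trivial objects
  (`div(B) = 0 ⊕ ℤ`) and is invariant under base-field-theoretic pre-steps (`Div ∈ 0 × ℕ`, `Div_B(u) ∈ 0 ⊕ ℤ`), while it
  is `1` on `(•, n₀)` (`not_exists_linked_shift_A0`).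
So `UnitToy.not_hullEssImageObjClause : ¬ frdFull.HullEssImageObjClause` and the closure over the row's own binders at
universe `0`, `TemperedFrobenioid.not_forall_hullEssImageObjClause`. Only the implication "essential image ⟹ linked"
fails; the refuted closure is NOT a restatement of any tree theorem (the instance forms above are positive and over
other vocabularies). FACT-LIST class: «universal-closure REFUTED / schema; instance forms in tree (p417120, weak twin)».
HONEST FRAMING: bookkeeping about the typing; the witness violates print's standing hypothesis (divisorial `Φ`) by
design and says nothing about [EtTh] Rmk. 3.6.3 or Cor. 3.8; nothing here bears on [IUTchIII] Cor. 3.12; no side taken;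
typed ≠ proved.
-/

namespace Literature.AnabelianGeometry.EtaleTheta

open CategoryTheory Opposite Literature.AlgebraicGeometry.Frobenioids

universe u₀ v₀ u v w

/-! ## The mechanism, over ANY vocabulary: unit classes lie in the essential image of the hull -/

namespace TemperedFrobenioid

variable {D₀ : Type u₀} [Category.{v₀} D₀] {V : FrdIMonoidStub.{w}} {T : RealifiedDivisorMonoids (D₀ := D₀) V}
  {D : Type u} [Category.{v} D] {VD : FrdICatStub.{u, v, w} D} (C : TemperedFrobenioid T D VD)

/-- Over ANY vocabulary `(V, VD)`: the class `of(d)` of a UNIT `d ∈ Φ(A)ˣ` lies in the essential image of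
`C^{bs-fld} → C` — `(1, id, d, 1) : (A, 0) = hull(A, 0) → (A, of d)` is an isomorphism of the model Frobenioid
([FrdI] Thm. 5.2 (i); L1's `ModelFrobenioid.isIso_of_isUnit_div`, `B` being group-like by Def. 3.6 (i)). For print's
divisorial (sharp) `Φ` this is the empty remark `d = 0`; for the typed interface it is the gap between the two sides
of Rmk. 3.6.3's object clause. [cite: MochizukiFrdI2008, Thm. 5.2(i) p.100] -/
theorem essImageObj_hull_of_isUnit (a : D) {d : (C.divisorMonoid.obj (op a) : Type w)} (hd : IsUnit d) :
    essImageObj C.hull ⟨a, Algebra.GrothendieckGroup.of d⟩ := by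
  let X₀ : C.hullCategory := ⟨a, 1⟩
  let A : C.category := ⟨a, Algebra.GrothendieckGroup.of d⟩
  let φ : C.hull.obj X₀ ⟶ A := ModelFrobenioid.mkHom (C.hull.obj X₀) A 1 (𝟙 a) d 1 (by
    change (C.bsFldInclGpM (op a) 1) ^ ((1 : ℕ+) : ℕ) * Algebra.GrothendieckGroup.of d =
      pullGp C.divisorMonoid (𝟙 a) (Algebra.GrothendieckGroup.of d) *
        Literature.AlgebraicGeometry.Frobenioids.divB C.divisorMonoid C.ratFnFunctor C.divBNatTrans (op a) 1
    rw [map_one, one_pow, one_mul, pullGp_id, map_one, mul_one])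
  haveI : IsIso (ModelFrobenioid.baseMap φ) := (inferInstance : IsIso (𝟙 a))
  haveI : IsIso φ := ModelFrobenioid.isIso_of_isUnit_div (C.ratFnFunctor_isGroupLike T.isUnit_BΛ) φ hd rfl
  exact ⟨X₀, ⟨asIso φ⟩⟩

end TemperedFrobenioid

namespace UnitToy

/-! ## `Ψ(•,0) = (•, n₀)` lies in the essential image of the hull of `frdFull` -/

/-- `(•, n₀)` lies in the essential image of `frdFull^{bs-fld} → frdFull`: it is isomorphic, by the UNIT isomorphism
`(1, id, n₀, 1)` (`shiftIso`), to `(•, 0) = hull(•, 0)`. [cite: MochizukiEtTh2009, Rmk 3.6.3 p.79] -/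
theorem essImageObj_hull_shift_A0 : essImageObj frdFull.hull (shiftObj A0) := by
  refine ⟨⟨pt, 1⟩, ⟨eqToIso ?_ ≪≫ shiftIso A0⟩⟩
  change (⟨pt, frdFull.bsFldInclGpM (op pt) 1⟩ : frdFull.category) = ⟨pt, 1⟩
  rw [map_one]

/-! ## The `ℤ`-coordinate of the class: `0` on Frobenius-trivial objects, invariant under base-field-theoretic
pre-steps, `1` on `(•, n₀)` -/

/-- A Frobenius-trivial object `(A, α)` of `frdFull` has `α = Div_B(u) ∈ div(B) = 0 ⊕ ℤ` (from its degree-`2`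
base-identity isometric endomorphism `ζ(2)`: `2α = α + Div_B(u)`), so the `ℤ`-coordinate of `α` is `0`.
[cite: MochizukiFrdI2008, Def. 1.2 (iv) p.22] -/
theorem fstR_cls_of_isFrobeniusTrivial (X : frdFull.category) (hX : frdFull.opsData.IsFrobeniusTrivial X) :
    fstR (frdFull.ΦgpToRlog (op X.base) X.cls) = 1 := by
  obtain ⟨ζ, hζ⟩ := hX
  obtain ⟨hdeg, -, ⟨-, hiso⟩, -⟩ := hζ 2
  have hrel := ModelFrobenioid.rel (ζ 2)
  change ModelFrobenioid.degFr (ζ 2) = 2 at hdeg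
  change ModelFrobenioid.div (ζ 2) = 1 at hiso
  rw [hdeg, hiso, map_one, mul_one, Subsingleton.elim (ModelFrobenioid.baseMap (ζ 2)) (𝟙 X.base), pullGp_id,
    show (((2 : ℕ+) : ℕ)) = 2 from rfl, pow_two, divB_apply] at hrel
  -- `hrel : α * α = α * ξ_u`, hence `α = ξ_u`, the `Φ^gp`-component of the rational function `u = (b, ξ_u)`
  have hξ := mul_left_cancel hrel
  rw [hξ, ← mem_ratFn, fstR_divHom]

/-- A base-field-theoretic pre-step `(1, Base, Div ∈ 0 × ℕ, u) : (•, α) → (•, β)` of `frdFull` does not change the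
`ℤ`-coordinate of the class: `α + Div = β + Div_B(u)` with `Div, Div_B(u) ∈ 0 ⊕ ℤ`.
[cite: MochizukiEtTh2009, Def 3.6 p.78] -/
theorem fstR_cls_eq_of_bsFldPreStep {X Y : frdFull.category} (φ : X ⟶ Y) (hφ : frdFull.opsData.IsPreStep φ)
    (hbs : frdFull.IsBaseFieldTheoretic φ) :
    fstR (frdFull.ΦgpToRlog (op X.base) X.cls) = fstR (frdFull.ΦgpToRlog (op Y.base) Y.cls) := by
  -- the `ℤ`-coordinate of a class, as a homomorphism on the model Frobenioid's copy of `Φ(X.base)^gp`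
  let j : Algebra.GrothendieckGroup (frdFull.divisorMonoid.obj (op X.base) : Type) →* Multiplicative ℤ :=
    fstR.comp (frdFull.ΦgpToRlog (op X.base))
  have hd : ModelFrobenioid.degFr φ = 1 := hφ.1
  -- `Div(φ) ∈ Φ^{bs-fld} = 0 × ℕ`
  have hdiv : j (Algebra.GrothendieckGroup.of (ModelFrobenioid.div φ)) = 1 :=
    (fstR_ΦgpToRlog_of (op X.base) (ModelFrobenioid.div φ)).trans ((mem_bs_iff _ _ _ _).1 hbs)
  -- `Div_B(u_φ) ∈ div(B) = 0 ⊕ ℤ`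
  have hu : j (ModelFrobenioid.unit φ).1.2 = 1 :=
    (congrArg fstR (mem_ratFn (op X.base) (ModelFrobenioid.unit φ))).symm.trans (fstR_divHom _)
  -- pulling back along `Base(φ)` does not change the `ℤ`-coordinate (`Φ^{ℝ-log}` is constant over `pt`)
  have hpull : j (pullGp frdFull.divisorMonoid (ModelFrobenioid.baseMap φ) Y.cls) =
      fstR (frdFull.ΦgpToRlog (op Y.base) Y.cls) :=
    (congrArg fstR (frdFull.ΦgpToRlog_pull (ModelFrobenioid.baseMap φ).op Y.cls)).trans
      (congrArg fstR (gpMap_id_apply _))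
  -- take `ℤ`-coordinates in `deg_Fr(φ) · x + Div(φ) = Φ(Base φ)(y) + Div_B(u_φ)`
  have hrel := congrArg j (ModelFrobenioid.rel φ)
  rw [map_mul, map_mul, map_pow, hd, PNat.one_coe, pow_one, hdiv, mul_one, hpull, divB_apply, hu, mul_one] at hrel
  exact hrel

/-- Hence the `ℤ`-coordinate of the class is constant along zigzags of base-field-theoretic pre-steps ("linked",
Rmk. 3.6.3). [cite: MochizukiEtTh2009, Rmk 3.6.3 p.79] -/
theorem fstR_cls_eq_of_linked {X Y : frdFull.category} (h : frdFull.LinkedByBsFldPreSteps X Y) :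
    fstR (frdFull.ΦgpToRlog (op X.base) X.cls) = fstR (frdFull.ΦgpToRlog (op Y.base) Y.cls) := by
  induction h with
  | rel X Y hXY =>
      obtain ⟨φ, hφ, hbs⟩ := hXY
      exact fstR_cls_eq_of_bsFldPreStep φ hφ hbs
  | refl X => rfl
  | symm X Y _ ih => exact ih.symm
  | trans X Y Z _ _ ih₁ ih₂ => exact ih₁.trans ih₂

/-- The `ℤ`-coordinate of the class of `(•, n₀)` is `1`. [cite: MochizukiEtTh2009, Def 3.6 p.77] -/
theorem fstR_cls_shift_A0 :
    fstR (frdFull.ΦgpToRlog (op pt) (shiftObj A0).cls) = Multiplicative.ofAdd (1 : ℤ) := by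
  have hc : (shiftObj A0).cls = Algebra.GrothendieckGroup.of (n₀Φ (op pt)) := one_mul _
  rw [hc]
  exact (fstR_ΦgpToRlog_of (op pt) (n₀Φ (op pt))).trans rfl

/-- `(•, n₀)` is NOT "linked to a Frobenius-trivial object via base-field theoretic pre-steps": the `ℤ`-coordinate of
the class is `0` on Frobenius-trivial objects and along the linking zigzags, but `1` on `(•, n₀)`.
[cite: MochizukiEtTh2009, Rmk 3.6.3 p.79] -/
theorem not_exists_linked_shift_A0 :
    ¬ ∃ A₀ : frdFull.category,
        frdFull.opsData.IsFrobeniusTrivial A₀ ∧ frdFull.LinkedByBsFldPreSteps A₀ (shiftObj A0) := by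
  rintro ⟨A₀, hA₀, hlink⟩
  have h := fstR_cls_eq_of_linked hlink
  rw [fstR_cls_of_isFrobeniusTrivial A₀ hA₀] at h
  have h1 : (1 : Multiplicative ℤ) = Multiplicative.ofAdd (1 : ℤ) := h.trans fstR_cls_shift_A0
  exact absurd (congrArg Multiplicative.toAdd h1) (by simp)

/-! ## Row C38-L10a fails at `frdFull`; the universal closure of F-2824 -/

/-- **Row C38-L10a (Rmk. 3.6.3, object clause) FAILS at the tempered Frobenioid `UnitToy.frdFull` AS TYPED**
(`Φ = ℤ × ℕ` has a unit): `(•, n₀)` is in the essential image of the hull but is linked to no Frobenius-trivial object.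
[cite: MochizukiEtTh2009, Rmk 3.6.3 p.79] -/
theorem not_hullEssImageObjClause : ¬ frdFull.HullEssImageObjClause := fun h =>
  not_exists_linked_shift_A0 ((h (shiftObj A0)).1 essImageObj_hull_shift_A0)

end UnitToy

/-- **F-2824 (`TemperedFrobenioid.HullEssImageObjClause`, row C38-L10a = [EtTh] Rmk. 3.6.3, object clause) —
universal closure over the typed Def. 3.6 interface REFUTED** (binders = the row's own `(D₀, V, T, D, VD, C)`, universe
`0`): at `UnitToy.frdFull` (trivial [FrdI] vocabulary, `Φ = ℤ × ℕ` with the unit `n₀`) the object `(•, n₀)` is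
isomorphic to `hull(•, 0)` by the unit isomorphism `(1, id, n₀, 1)` but is linked to no Frobenius-trivial object
(`ℤ`-coordinate of the class). The two sides of the clause differ exactly by the unit classes `of(Φ(A)ˣ)`, trivial for
print's divisorial (sharp) `Φ`: the row HOLDS at the data the cone consumes — `hullEssImageObjClause_holds`
(`treeMonoidVocab`, p417120) and `hullEssImageObjClause_holds_weak` (`treeMonoidVocabWeak`) — and is admissible AT
NAMED INSTANCES ONLY. [cite: MochizukiEtTh2009, Rmk 3.6.3 p.79] -/
theorem TemperedFrobenioid.not_forall_hullEssImageObjClause :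
    ¬ ∀ (D₀ : Type) (_ : Category.{0} D₀) (V : FrdIMonoidStub.{0}) (T : RealifiedDivisorMonoids (D₀ := D₀) V)
        (D : Type) (_ : Category.{0} D) (VD : FrdICatStub.{0, 0, 0} D) (C : TemperedFrobenioid T D VD),
        C.HullEssImageObjClause := fun H =>
  UnitToy.not_hullEssImageObjClause (H _ _ _ _ _ _ _ UnitToy.frdFull)

end Literature.AnabelianGeometry.EtaleTheta
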